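import Summits.ValiantsHypothesis.ValiantsHypothesis.Theses.BarrierLever
import Literature.Barriers.ValiantsHypothesis.CKRST20IntegerBoxNaturalProofs

/-!
# Route BarrierLever — item 18972 `NaturalProofsSeparateVNP`: the RELATIVE separation that
# KRST 2022 + CKRST 2020 do give (conditional on exponential hardness of the permanent)

Helper file (`--supports stmt-ValiantsHypothesis-18972`; cell valiant-natproofs, rung V4, seat val-np-p4
gen 9). It closes NO item. The seat's docket reads «18972 `NaturalProofsSeparateVNP` from
`BarrierLeverKRST2022.lean` + the CKRST facts val-lit types». The item asks for LEVEL-ONE natural proofs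
vanishing on ALL of `SmallCircuits ℂ n b` (every `b`, infinitely often) with a non-root in the
`VNP`-succinct class `SmallDefinable ℂ n b₁`; that statement implies `VP ≠ VNP`
(`valiantsHypothesis_of_naturalProofsSeparateVNP`) and is parked behind crux stmt-ValiantsHypothesis-14610.
What the two printed theorems DO give, once composed in the tree's frame, is the RELATIVE statement with
the vanishing restricted to a bounded-coefficient slice of `VP`:

* `relSeparate_intBox_of_permanentExpHard` — under `PermanentExpHardWith ℂ c m₀` there is ONE
  `VNP` exponent `b₁` (KRST's) such that for EVERY box height exponent `a₀` the CKRST box-equations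
  `D_n ∈ Distinguishers ℂ n (a₀ + 6)` (one family for all `b`; tree: `CKRST2020.intBox_frame_uniform`,
  CKRST 2020 Thm. 1.6 with the §1.3 remark «coefficients as large as N») vanish, for every `b` and all
  large `n`, on `SmallCircuits ℂ n b ∩ box(N^{a₀})` and are NONZERO at some `g ∈ SmallDefinable ℂ n b₁`
  (KRST 2022 Main Theorem, tree: `succinctHittingSetsFromVNP_of_permanentExpHard`); such a `g` lies
  outside `SmallCircuits ℂ n b ∩ box(N^{a₀})`.
* `relSeparate_signSlice_of_permanentExpHard` — the `{-1,0,1}`-slice version (CKRST Thm. 1.6 as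
  printed, tree: `CKRST2020_thm_1_1_holds.frame`).
* `vnpBoxEquations_nonroot_outside_box_of_permanentExpHard` — CKRST Thm. 1.8 (equations for
  `VNP ∩ box`, tree: `CKRST2020.intBox_frame_vnp'`) composed the same way: under per-hardness those
  equations have non-roots in `SmallDefinable ℂ n b₁` itself, necessarily OUTSIDE the box.
* `naturalProofsSeparateVNP_iff_relSeparate_univ` — the item is literally the same shape with the
  slice `box(N^{a₀})` replaced by `Set.univ` (and level `1`, infinitely often): the distance between the
  conditional theorem and the item is exactly the coefficient-axis window of the door
  (items 19905 / 19906 / 20033 / 20037 / 19793: transfer from the box to all of `SmallCircuits` is known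
  only at box height `N^{(a+1)(2n+1)}`, fails below the degree, and generator-based transfer cannot go
  below `≈ a·n/log n`).

READING. The box-relative statement does NOT reduce to level one by the item's stretching trick
(`…ExponentOne.restrict_stretch`): a polynomial stretch `n ↦ m = n^K` turns the box `N_m^{a₀}` into
`N_n^{a₀ n^{K-1}}`, which no fixed level at `n` covers — the box is not scale-invariant, the class
`Set.univ` is. So the conditional relative separation lives at level `a₀ + 6` for box height `N^{a₀}`.

WHAT THIS IS NOT: no progress on item 18972, on crux 14610 (FSV Question 6) or on `VP` versus `VNP`
(`VP ≠ VNP` is NOT proved); every statement here is either unconditional CKRST bookkeeping or conditional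
on `PermanentExpHardWith ℂ c m₀` (an open hypothesis implying `VP ≠ VNP`, never asserted).
-/

-- layout Summits/ValiantsHypothesis/ValiantsHypothesis forces the duplicated namespace component
set_option linter.dupNamespace false

namespace Summit.ValiantsHypothesis.ValiantsHypothesis.Theorems.BarrierLever.NaturalProofsSeparateVNP.Relative

open MvPolynomial Literature.Barriers.ValiantsHypothesis

/-- **Relative separation on integer boxes, under exponential hardness of the permanent** (KRST 2022
Main Theorem ∘ CKRST 2020 Thm. 1.6 with large coefficients): one `VNP` exponent `b₁` such that for every
box height exponent `a₀` ONE family `D_n ∈ Distinguishers ℂ n (a₀+6)` is, for every size exponent `b`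
and all large `n`, a natural proof against `SmallCircuits ℂ n b` relative to the box
`[-N^{a₀}, N^{a₀}]` (`N = C(2n,n)`) which is nonzero at some member of `SmallDefinable ℂ n b₁`; that
member is not a box member of `SmallCircuits ℂ n b`. -/
theorem relSeparate_intBox_of_permanentExpHard {c m₀ : ℕ} (hper : PermanentExpHardWith ℂ c m₀) :
    ∃ b₁ : ℕ, ∀ a₀ : ℕ, ∃ D : (n : ℕ) → MvPolynomial (degLEMonomials n) ℂ,
      ∀ b : ℕ, ∃ n₀ : ℕ, ∀ n ≥ n₀,
        IsNaturalProofRel (degLEMonomials n) (intBoxSlice ℂ n (((2 * n).choose n) ^ a₀))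
          (SmallCircuits ℂ n b) (Distinguishers ℂ n (a₀ + 6)) (D n) ∧
        ∃ g ∈ SmallDefinable ℂ n b₁,
          eval (coeffVector (degLEMonomials n) g) (D n) ≠ 0 ∧
          ¬ (g ∈ SmallCircuits ℂ n b ∧ g ∈ intBoxSlice ℂ n (((2 * n).choose n) ^ a₀)) := by
  obtain ⟨b₁, hb₁⟩ := succinctHittingSetsFromVNP_of_permanentExpHard hper
  refine ⟨b₁, fun a₀ => ?_⟩
  obtain ⟨D, hD⟩ := CKRST2020.intBox_frame_uniform a₀
  obtain ⟨n₁, hn₁⟩ := hb₁ (a₀ + 6)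
  refine ⟨D, fun b => ?_⟩
  obtain ⟨n₀, hn₀⟩ := hD b
  refine ⟨max n₀ n₁, fun n hn => ?_⟩
  obtain ⟨hrel, -⟩ := hn₀ n ((le_max_left _ _).trans hn)
  obtain ⟨hD𝒟, ⟨g₀, hg₀P, hg₀⟩, hvan⟩ := hrel
  have hD0 : D n ≠ 0 := fun h => hg₀ (by rw [h, map_zero])
  obtain ⟨g, hg, hgD⟩ := hn₁ n ((le_max_right _ _).trans hn) (D n) hD𝒟 hD0
  exact ⟨⟨hD𝒟, ⟨g₀, hg₀P, hg₀⟩, hvan⟩, g, hg, hgD, fun hmem => hgD (hvan g hmem.1 hmem.2)⟩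

/-- **Relative separation on the `{-1,0,1}` slice, under exponential hardness of the permanent**
(KRST 2022 Main Theorem ∘ CKRST 2020 Thm. 1.6 as printed, tree `CKRST2020_thm_1_1_holds.frame`):
one level `a`, one `VNP` exponent `b₁`, ONE family `D_n` which for every `b` and all large `n` vanishes
on the `{-1,0,1}`-coefficient members of `SmallCircuits ℂ n b` and is nonzero at some member of
`SmallDefinable ℂ n b₁`. -/
theorem relSeparate_signSlice_of_permanentExpHard {c m₀ : ℕ} (hper : PermanentExpHardWith ℂ c m₀) :
    ∃ (a b₁ : ℕ) (D : (n : ℕ) → MvPolynomial (degLEMonomials n) ℂ),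
      ∀ b : ℕ, ∃ n₀ : ℕ, ∀ n ≥ n₀,
        IsNaturalProofRel (degLEMonomials n) (signCoeffSlice ℂ n) (SmallCircuits ℂ n b)
          (Distinguishers ℂ n a) (D n) ∧
        ∃ g ∈ SmallDefinable ℂ n b₁,
          eval (coeffVector (degLEMonomials n) g) (D n) ≠ 0 ∧
          ¬ (g ∈ SmallCircuits ℂ n b ∧ g ∈ signCoeffSlice ℂ n) := by
  obtain ⟨b₁, hb₁⟩ := succinctHittingSetsFromVNP_of_permanentExpHard hper
  obtain ⟨a, D, hD⟩ := CKRST2020_thm_1_1_holds.frame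
  obtain ⟨n₁, hn₁⟩ := hb₁ a
  refine ⟨a, b₁, D, fun b => ?_⟩
  obtain ⟨n₀, hn₀⟩ := hD b
  refine ⟨max n₀ n₁, fun n hn => ?_⟩
  obtain ⟨hrel, -⟩ := hn₀ n ((le_max_left _ _).trans hn)
  obtain ⟨hD𝒟, ⟨g₀, hg₀P, hg₀⟩, hvan⟩ := hrel
  have hD0 : D n ≠ 0 := fun h => hg₀ (by rw [h, map_zero])
  obtain ⟨g, hg, hgD⟩ := hn₁ n ((le_max_right _ _).trans hn) (D n) hD𝒟 hD0
  exact ⟨⟨hD𝒟, ⟨g₀, hg₀P, hg₀⟩, hvan⟩, g, hg, hgD, fun hmem => hgD (hvan g hmem.1 hmem.2)⟩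

/-- **CKRST's equations for `VNP ∩ box` have non-roots in `VNP` outside the box, under exponential
hardness of the permanent** (KRST 2022 Main Theorem ∘ CKRST 2020 Thm. 1.8 with large coefficients,
tree `CKRST2020.intBox_frame_vnp'`): for KRST's exponent `b₁` and every `a₀`, one family
`D_n ∈ Distinguishers ℂ n a` vanishing for all large `n` on the box members of `SmallDefinable ℂ n b₁`
is nonzero at some member of `SmallDefinable ℂ n b₁` — whose coefficients are therefore NOT all
integers of modulus `≤ N^{a₀}`. -/
theorem vnpBoxEquations_nonroot_outside_box_of_permanentExpHard {c m₀ : ℕ}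
    (hper : PermanentExpHardWith ℂ c m₀) :
    ∃ b₁ : ℕ, ∀ a₀ : ℕ, ∃ (a : ℕ) (D : (n : ℕ) → MvPolynomial (degLEMonomials n) ℂ) (n₀ : ℕ),
      ∀ n ≥ n₀,
        IsNaturalProofRel (degLEMonomials n) (intBoxSlice ℂ n (((2 * n).choose n) ^ a₀))
          (SmallDefinable ℂ n b₁) (Distinguishers ℂ n a) (D n) ∧
        ∃ g ∈ SmallDefinable ℂ n b₁,
          g ∉ intBoxSlice ℂ n (((2 * n).choose n) ^ a₀) ∧
          eval (coeffVector (degLEMonomials n) g) (D n) ≠ 0 := by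
  obtain ⟨b₁, hb₁⟩ := succinctHittingSetsFromVNP_of_permanentExpHard hper
  refine ⟨b₁, fun a₀ => ?_⟩
  obtain ⟨a, D, hD⟩ := CKRST2020.intBox_frame_vnp' a₀
  obtain ⟨n₁, hn₁⟩ := hb₁ a
  obtain ⟨n₀, hn₀⟩ := hD b₁
  refine ⟨a, D, max n₀ n₁, fun n hn => ?_⟩
  obtain ⟨hrel, -⟩ := hn₀ n ((le_max_left _ _).trans hn)
  obtain ⟨hD𝒟, ⟨g₀, hg₀P, hg₀⟩, hvan⟩ := hrel
  have hD0 : D n ≠ 0 := fun h => hg₀ (by rw [h, map_zero])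
  obtain ⟨g, hg, hgD⟩ := hn₁ n ((le_max_right _ _).trans hn) (D n) hD𝒟 hD0
  exact ⟨⟨hD𝒟, ⟨g₀, hg₀P, hg₀⟩, hvan⟩, g, hg, fun hbox => hgD (hvan g hg hbox), hgD⟩

/-- **The item in the same vocabulary**: `NaturalProofsSeparateVNP` is the relative separation with
the slice `Set.univ` (vanishing on ALL of `SmallCircuits ℂ n b`), at level `1`, infinitely often —
compare `relSeparate_intBox_of_permanentExpHard` (slice `box(N^{a₀})`, level `a₀ + 6`, all large `n`,
conditional). -/
theorem naturalProofsSeparateVNP_iff_relSeparate_univ :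
    Theses.BarrierLever.NaturalProofsSeparateVNP ↔
      ∃ b₁ : ℕ, ∀ b n₀ : ℕ, ∃ n : ℕ, n₀ ≤ n ∧
        ∃ D : MvPolynomial (degLEMonomials n) ℂ,
          IsNaturalProofRel (degLEMonomials n) Set.univ (SmallCircuits ℂ n b)
            (Distinguishers ℂ n 1) D ∧
          ∃ g ∈ SmallDefinable ℂ n b₁, eval (coeffVector (degLEMonomials n) g) D ≠ 0 := by
  unfold Theses.BarrierLever.NaturalProofsSeparateVNP
  refine exists_congr fun b₁ => forall_congr' fun b => forall_congr' fun n₀ =>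
    exists_congr fun n => and_congr_right fun _ => exists_congr fun D => ⟨?_, ?_⟩
  · rintro ⟨⟨hD, -, hvan⟩, g, hg, hne⟩
    exact ⟨⟨hD, ⟨g, trivial, hne⟩, fun f hf _ => hvan f hf⟩, g, hg, hne⟩
  · rintro ⟨⟨hD, -, hvan⟩, g, hg, hne⟩
    have hD0 : D ≠ 0 := by rintro rfl; simp at hne
    exact ⟨⟨hD, hD0, fun f hf => hvan f hf trivial⟩, g, hg, hne⟩

/-- Unconditional form of the comparison: the box-relative separation holds for the item's own target
class WHENEVER `SmallDefinable ℂ n b₁` hits level-`(a₀+6)` distinguishers for large `n` (the KRST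
conclusion taken as hypothesis, no hardness assumption named) — CKRST supplies the vanishing side
unconditionally. -/
theorem relSeparate_intBox_of_hits {b₁ a₀ : ℕ}
    (hhit : ∃ n₁ : ℕ, ∀ n ≥ n₁, IsSuccinctHittingSet (degLEMonomials n) (SmallDefinable ℂ n b₁)
      (Distinguishers ℂ n (a₀ + 6))) :
    ∃ D : (n : ℕ) → MvPolynomial (degLEMonomials n) ℂ, ∀ b : ℕ, ∃ n₀ : ℕ, ∀ n ≥ n₀,
      IsNaturalProofRel (degLEMonomials n) (intBoxSlice ℂ n (((2 * n).choose n) ^ a₀))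
        (SmallCircuits ℂ n b) (Distinguishers ℂ n (a₀ + 6)) (D n) ∧
      ∃ g ∈ SmallDefinable ℂ n b₁, eval (coeffVector (degLEMonomials n) g) (D n) ≠ 0 := by
  obtain ⟨n₁, hn₁⟩ := hhit
  obtain ⟨D, hD⟩ := CKRST2020.intBox_frame_uniform a₀
  refine ⟨D, fun b => ?_⟩
  obtain ⟨n₀, hn₀⟩ := hD b
  refine ⟨max n₀ n₁, fun n hn => ?_⟩
  obtain ⟨hrel, -⟩ := hn₀ n ((le_max_left _ _).trans hn)
  obtain ⟨hD𝒟, ⟨g₀, hg₀P, hg₀⟩, hvan⟩ := hrel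
  have hD0 : D n ≠ 0 := fun h => hg₀ (by rw [h, map_zero])
  obtain ⟨g, hg, hgD⟩ := hn₁ n ((le_max_right _ _).trans hn) (D n) hD𝒟 hD0
  exact ⟨⟨hD𝒟, ⟨g₀, hg₀P, hg₀⟩, hvan⟩, g, hg, hgD⟩

end Summit.ValiantsHypothesis.ValiantsHypothesis.Theorems.BarrierLever.NaturalProofsSeparateVNP.Relative
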